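import Summits.BirchSwinnertonDyer.BirchSwinnertonDyer.Theorems.EisensteinPrimesAcTwistDeformationCofreeRank
import Summits.BirchSwinnertonDyer.BirchSwinnertonDyer.Theorems.SignedBaseChangeAnticyclotomicEisensteinDivisibilityCofreeTateDual
import Mathlib.LinearAlgebra.Matrix.Trace
import Mathlib.LinearAlgebra.Matrix.Determinant.Basic
import HarnessLib

/-!
# Route `EisensteinPrimes` (rung K5), crux 2 `GoodLatticeBDPValue`, line `halves` v19.1, V21 index road
# input S2 (SUR_f at `v̄`) — the arena, part 5 (instance algebra): dual-basis FAMILIES from a dual datum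
# with a `ℤ_p`-basis, the UNIFORM cyclotomic scalar on `Hom(A, K̄ˣ)`, and CAYLEY–HAMILTON `2 × 2`
# (`B² = tr·B − det`, `det ≠ 0` for invertible `B`) read through a rank-2 Pontryagin dual basis
# (helper for stmt-BirchSwinnertonDyer-19032)

Cell `bsd-eis` (home `run/shared/lean/pub/bsd-eis/`), seat `bsd-line-x1-p1-w3` gen 3 (D-0154 width seat
on crux 2 `GoodLatticeBDPValue`, line `halves` v19.1; LEAD g4's V21 index road §4 S2, curve side). The
seat's corank-`n` arena (`…CofreeRank` p642980, `…SURRank` p644452, `…LOC1Rank` p644527) consumes (a)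
DUAL-BASIS FAMILIES `j : Fin n → Hom(A, C)` (`c ↦ Σ_k j_k ∘ (c_k • ·)` bijective `ℤ_pⁿ ≅ Hom(A, C)`), (b) ONE
scalar `w` through which `σ` acts on every `j_k(A) ⊆ K̄ˣ`, (c) a monic QUADRATIC `ρ₀(σ̄)² = t·ρ₀(σ̄) − d`,
`d ≠ 0`. For `A = E[p^∞] = PrimaryTorsion W.geomPoints p` cell `bsd-ssimc` supplies dual data WITH A
`ℤ_p`-BASIS (`SignedBaseChangeAcDivCofree.exists_tateDual_basis_primaryTorsion`, `exists_dual_basis_of_free`: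
`∃ Y tA, IsDualPairing ℤ_p A tA ∧ ∃ n, Basis (Fin n) ℤ_p Y`). THIS FILE is the generic algebra turning
that supply into (a)–(c):

* §1 **`dualBasis_hinj_hsurj`** — from `IsDualPairing ℤ_[p] A tA` and `b : Basis (Fin n) ℤ_p Y`, the family
  `j_k := tA (b k)` satisfies `hinj`/`hsurj` (coordinates `b.equivFun`, balance `tA (c • y) a = tA y (c • a)`).
* §2 **`exists_forall_units_apply_eq_smul`** — for a `p`-primary `A` and `char K = 0` there is ONE
  `w ∈ ℤ_p` with `g · φ(a) = φ(w • a)` for EVERY additive `φ : A → K̄ˣ` and every `a` (`φ(A) ⊆ μ_{p^∞} =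
  j₀(ℚ_p/ℤ_p)` by the torsion count, `g` acts on `j₀` by a scalar `w`
  (`QpModZp.exists_units_apply_eq_smul`), and `w • a = (w mod p^k) • a` on `p^k`-torsion).
* §3 matrices of endomorphisms in a dual-basis family (`exists_matrix_repr`, `matrix_repr_comp`,
  `matrix_repr_unique`, `matrix_repr_id`), `det ≠ 0` for an endomorphism with a right inverse
  (`det_ne_zero_of_rightInverse`), the `2 × 2` Cayley–Hamilton identity `β² = tr β • β − det β • 1`
  (`matrix_two_mul_self`), and **`exists_quadratic_of_dualBasis_two`**: for a rank-2 Pontryagin dual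
  basis (`C = ℚ/ℤ`), every `ℤ_p`-linear `B` satisfies `B(B a) = t • B a − d • a` with `t = tr β`,
  `d = det β` (characters separate points), and `d ≠ 0` if `B` has a right inverse.

Elementary and unconditional; THEOREMS ONLY; no named fact, no `sorry`. HONEST FRAMING: generic algebra;
closes nothing by itself (`--supports`); no summit statement / BSD / IMC2 / KY Thm. 1.4.1 (iii) is proved by
this file. References: [Greenberg2006] p. 338 L15–19 ("`T* = Hom(D, μ_{p^∞})` … `ρ* : Gal(K_Σ/K) →
GL_n(R)`"), p. 342 L35–36; [Greenberg2010] Lemma 5.2.2; [SilvermanAEC2009] III.7.1, III.8 (the Galois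
action on `μ_{p^∞}` through the cyclotomic character; `det ρ_E` a unit).
-/

set_option autoImplicit false
set_option linter.dupNamespace false

noncomputable section

open scoped Classical
open Finset
open Literature.NumberTheory.EllipticCurves Literature.NumberTheory.IwasawaTheory
  Literature.NumberTheory.IwasawaTheory.Greenberg2016 Literature.NumberTheory.GaloisRepresentations

namespace Summit.BirchSwinnertonDyer.BirchSwinnertonDyer.Theorems.AcTwistDeformation

/-! ## §1 Dual-basis families from a dual datum with a `ℤ_p`-basis -/

section Adapter

variable {p : ℕ} [Fact p.Prime] {A : Type} [AddCommGroup A] [Module ℤ_[p] A]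
  {C : Type*} [AddCommGroup C] {Y : Type} [AddCommGroup Y] [Module ℤ_[p] Y]
  {tA : Y →+ (A →+ C)} {n : ℕ}

/-- **A `ℤ_p`-basis of a dual datum gives a dual-basis FAMILY**: if `tA : Y ≅ Hom(A, C)` is a balanced dual
(`IsDualPairing ℤ_[p] A tA`) and `b` is a basis of `Y` indexed by `Fin n`, then for `j_k := tA (b k)` the map
`c ↦ Σ_k j_k ∘ (c_k • ·)` is injective and onto `Hom(A, C)` — the hypotheses `hinj`/`hsurj` of the seat's
corank-`n` arena (`isCofree_bigRepModule_pi`, `bigRep_LOC1_of_quadratic`, …).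
[cite: Greenberg2006, p. 338 L15–19 (T* free of rank n)] -/
theorem dualBasis_hinj_hsurj (hY : IsDualPairing ℤ_[p] A tA) (b : Module.Basis (Fin n) ℤ_[p] Y) :
    (∀ c : Fin n → ℤ_[p], (∀ a : A, ∑ k, tA (b k) (c k • a) = 0) → c = 0) ∧
      ∀ φ : A →+ C, ∃ c : Fin n → ℤ_[p], ∀ a : A, φ a = ∑ k, tA (b k) (c k • a) := by
  have hsum : ∀ (c : Fin n → ℤ_[p]) (a : A), tA (∑ k, c k • b k) a = ∑ k, tA (b k) (c k • a) := by
    intro c a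
    rw [map_sum, AddMonoidHom.finsetSum_apply]
    exact sum_congr rfl fun k _ ↦ hY.map_smul (c k) (b k) a
  refine ⟨fun c hc ↦ ?_, fun φ ↦ ?_⟩
  · have h0 : ∑ k, c k • b k = 0 := by
      apply hY.injective
      ext a
      rw [hsum, hc, map_zero, AddMonoidHom.zero_apply]
    exact funext fun k ↦ Fintype.linearIndependent_iff.mp b.linearIndependent c h0 k
  · obtain ⟨y, hy⟩ := hY.bijective.2 φ
    refine ⟨b.equivFun y, fun a ↦ ?_⟩
    rw [← hsum, b.sum_equivFun, hy]

end Adapter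

/-! ## §2 The uniform cyclotomic scalar on `Hom(A, K̄ˣ)` -/

section Cyclotomic

variable {p : ℕ} [hp : Fact p.Prime] {A : Type*} [AddCommGroup A] [Module ℤ_[p] A]

/-- On a `p^k`-torsion element a `p`-adic scalar acts through its residue `mod p^k`.
[cite: Hungerford1974, Ch. I §3 Exercise 7 (b)] -/
theorem smul_eq_appr_smul_of_pow_nsmul_eq_zero {a : A} {k : ℕ} (ha : p ^ k • a = 0) (w : ℤ_[p]) :
    w • a = w.appr k • a := by
  obtain ⟨e, he⟩ := Ideal.mem_span_singleton'.mp (PadicInt.appr_spec k w)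
  rw [← Nat.cast_smul_eq_nsmul ℤ_[p] (w.appr k), ← sub_eq_zero, ← sub_smul, ← he, mul_smul,
    ← Nat.cast_pow, Nat.cast_smul_eq_nsmul, ha, smul_zero]

/-- **ONE cyclotomic scalar for all of `Hom(A, K̄ˣ)`**: for a `p`-primary `A` and `char K = 0`, every
`g ∈ Γ_K` has a `w ∈ ℤ_p` with `g · φ(a) = φ(w • a)` for EVERY additive `φ : A → K̄ˣ` and every `a ∈ A`
(the values lie in `μ_{p^∞} = j₀(ℚ_p/ℤ_p)` — torsion count `QpModZp.unitsCarrier_torsionBound` — on which `g`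
acts by the scalar `w`, `QpModZp.exists_units_apply_eq_smul`; `φ(w • a) = φ((w mod p^k) • a) = (w mod p^k) • φ a`).
This is the hypothesis `hw` of `bigRep_LOC1_of_quadratic` for ANY Tate dual-basis family.
[cite: Greenberg2006, p. 338 L15–19] [cite: SilvermanAEC2009, III.8 (Galois acts on μ_{p^∞} through the cyclotomic character)] -/
theorem exists_forall_units_apply_eq_smul (K : Type) [Field K] [CharZero K]
    (hA : ∀ a : A, ∃ k : ℕ, p ^ k • a = 0) (g : Field.absoluteGaloisGroup K) :
    ∃ w : ℤ_[p], ∀ (φ : A →+ DiscreteGaloisModule.UnitsCarrier K) (a : A),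
      DiscreteGaloisModule.units K g (φ a) = φ (w • a) := by
  obtain ⟨j₀, hj₀, -, hsurj₀⟩ :=
    QpModZp.exists_unitsCarrier_hinj_hsurj_of_linearEquiv K (LinearEquiv.refl ℤ_[p] (QpModZp p))
  obtain ⟨w, hw⟩ := QpModZp.exists_units_apply_eq_smul K j₀ hsurj₀ g
  refine ⟨w, fun φ a ↦ ?_⟩
  obtain ⟨k, hk⟩ := hA a
  -- `φ a = j₀ x` with `p^k x = 0`
  have hφa : p ^ k • φ a = 0 := by rw [← map_nsmul, hk, map_zero]
  obtain ⟨x, hx⟩ := SignedBaseChangeAcDivCofree.mem_range_of_pow_nsmul_eq_zero hj₀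
    (QpModZp.unitsCarrier_torsionBound K) hφa
  have hxk : p ^ k • x = 0 := hj₀ (by rw [map_nsmul, hx, hφa, map_zero])
  rw [← hx, hw, smul_eq_appr_smul_of_pow_nsmul_eq_zero hk, QpModZp.smul_eq_appr_smul_of_nsmul_eq_zero hxk,
    map_nsmul, map_nsmul, hx]

end Cyclotomic

/-! ## §3 Matrices in a dual-basis family and Cayley–Hamilton `2 × 2` -/

section Matrices

variable {p : ℕ} [Fact p.Prime] {A : Type*} [AddCommGroup A] [Module ℤ_[p] A]
  {C : Type*} [AddCommGroup C] {n : ℕ} {j : Fin n → (A →+ C)}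

/-- **The matrix of a `ℤ_p`-linear endomorphism in a dual-basis family**: `j_k ∘ B = Σ_l j_l ∘ (β_{kl} • ·)`
for some `β ∈ M_n(ℤ_p)` (row by row from `hsurj`). [cite: Greenberg2006, p. 338 L16–19 (ρ* : Gal → GL_n(R))] -/
theorem exists_matrix_repr (hsurj : ∀ φ : A →+ C, ∃ c : Fin n → ℤ_[p], ∀ a : A, φ a = ∑ k, j k (c k • a))
    (B : A →ₗ[ℤ_[p]] A) :
    ∃ β : Matrix (Fin n) (Fin n) ℤ_[p], ∀ (k : Fin n) (a : A), j k (B a) = ∑ l, j l (β k l • a) := by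
  choose β hβ using fun k ↦ hsurj ((j k).comp B.toAddMonoidHom)
  exact ⟨Matrix.of β, fun k a ↦ by simpa using hβ k a⟩

/-- **Composition is matrix product**: if `β` represents `B` and `β'` represents `B'`, then `β * β'`
represents `B ∘ B'`. [folklore] -/
theorem matrix_repr_comp {B B' : A →ₗ[ℤ_[p]] A} {β β' : Matrix (Fin n) (Fin n) ℤ_[p]}
    (hβ : ∀ (k : Fin n) (a : A), j k (B a) = ∑ l, j l (β k l • a))
    (hβ' : ∀ (k : Fin n) (a : A), j k (B' a) = ∑ l, j l (β' k l • a)) (k : Fin n) (a : A) :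
    j k (B (B' a)) = ∑ m, j m ((β * β') k m • a) := by
  rw [hβ]
  simp_rw [← map_smul B', hβ', smul_smul, Matrix.mul_apply, sum_smul, map_sum]
  rw [sum_comm]
  exact sum_congr rfl fun l _ ↦ sum_congr rfl fun m _ ↦ by rw [mul_comm]

/-- **Uniqueness of the representing matrix** (from `hinj`). [folklore] -/
theorem matrix_repr_unique (hinj : ∀ c : Fin n → ℤ_[p], (∀ a : A, ∑ k, j k (c k • a) = 0) → c = 0)
    {B : A →ₗ[ℤ_[p]] A} {β β' : Matrix (Fin n) (Fin n) ℤ_[p]}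
    (hβ : ∀ (k : Fin n) (a : A), j k (B a) = ∑ l, j l (β k l • a))
    (hβ' : ∀ (k : Fin n) (a : A), j k (B a) = ∑ l, j l (β' k l • a)) : β = β' := by
  ext k l
  have h := hinj (fun l ↦ β k l - β' k l) fun a ↦ by
    simp_rw [sub_smul, map_sub, sum_sub_distrib, ← hβ k a, ← hβ' k a, sub_self]
  simpa [sub_eq_zero] using congrFun h l

/-- The identity is represented by `1`. [folklore] -/
theorem matrix_repr_id (k : Fin n) (a : A) :
    j k ((LinearMap.id : A →ₗ[ℤ_[p]] A) a) = ∑ l, j l ((1 : Matrix (Fin n) (Fin n) ℤ_[p]) k l • a) := by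
  rw [LinearMap.id_apply, Finset.sum_eq_single k (fun l _ hl ↦ by
    rw [Matrix.one_apply_ne' hl, zero_smul, map_zero]) (fun h ↦ absurd (mem_univ k) h),
    Matrix.one_apply_eq, one_smul]

/-- **`det β ≠ 0` for an endomorphism with a right inverse** (`β β' = 1`; `ℤ_p` is non-trivial).
[cite: SilvermanAEC2009, III.8 (ρ_E(σ) ∈ Aut(E[p^∞]))] -/
theorem det_ne_zero_of_rightInverse
    (hinj : ∀ c : Fin n → ℤ_[p], (∀ a : A, ∑ k, j k (c k • a) = 0) → c = 0)
    (hsurj : ∀ φ : A →+ C, ∃ c : Fin n → ℤ_[p], ∀ a : A, φ a = ∑ k, j k (c k • a))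
    {B B' : A →ₗ[ℤ_[p]] A} (hBB' : ∀ a : A, B (B' a) = a) {β : Matrix (Fin n) (Fin n) ℤ_[p]}
    (hβ : ∀ (k : Fin n) (a : A), j k (B a) = ∑ l, j l (β k l • a)) : β.det ≠ 0 := by
  obtain ⟨β', hβ'⟩ := exists_matrix_repr hsurj B'
  have hprod : β * β' = 1 := by
    refine matrix_repr_unique (B := B.comp B') hinj (fun k a ↦ ?_) fun k a ↦ ?_
    · exact matrix_repr_comp hβ hβ' k a
    · rw [LinearMap.comp_apply, hBB']
      exact matrix_repr_id k a
  intro h0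
  have h1 := congrArg Matrix.det hprod
  rw [Matrix.det_mul, h0, zero_mul, Matrix.det_one] at h1
  exact zero_ne_one h1

omit [Fact p.Prime] in
/-- **Cayley–Hamilton for `2 × 2` matrices**: `β² = tr β • β − det β • 1` (entrywise).
[cite: SilvermanAEC2009, III.8.6 (det and trace of ρ_E on T_ℓ)] -/
theorem matrix_two_mul_self {R : Type*} [CommRing R] (β : Matrix (Fin 2) (Fin 2) R) :
    β * β = β.trace • β - β.det • (1 : Matrix (Fin 2) (Fin 2) R) := by
  ext i k
  rw [Matrix.trace_fin_two, Matrix.det_fin_two]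
  fin_cases i <;> fin_cases k <;>
    simp [Matrix.mul_apply, Fin.sum_univ_two] <;> ring

/-- **THE QUADRATIC RELATION FROM A RANK-2 PONTRYAGIN DUAL BASIS**: if `Hom(A, ℚ/ℤ) ≅ ℤ_p²` through
`j : Fin 2 → Hom(A, ℚ/ℤ)`, every `ℤ_p`-linear `B : A → A` satisfies `B(B a) = t • B a − d • a` with
`t = tr β`, `d = det β` for its matrix `β` (Cayley–Hamilton read through `j`, characters separate points);
and `d ≠ 0` whenever `B` has a right inverse — the hypotheses `hquad`, `hd` of `…LOC1Rank` for `E[p^∞]`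
(`t = a_σ`, `d = χ_cyc(σ)`). [cite: SilvermanAEC2009, III.8.6, V.2.3.1 (det ρ_ℓ = χ_cyc, tr = a)] -/
theorem exists_quadratic_of_dualBasis_two {j : Fin 2 → (A →+ AddCircle (1 : ℚ))}
    (hinj : ∀ c : Fin 2 → ℤ_[p], (∀ a : A, ∑ k, j k (c k • a) = 0) → c = 0)
    (hsurj : ∀ φ : A →+ AddCircle (1 : ℚ), ∃ c : Fin 2 → ℤ_[p], ∀ a : A, φ a = ∑ k, j k (c k • a))
    (B : A →ₗ[ℤ_[p]] A) :
    ∃ t d : ℤ_[p], (∀ a : A, B (B a) = t • B a - d • a) ∧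
      ((∃ B' : A →ₗ[ℤ_[p]] A, ∀ a : A, B (B' a) = a) → d ≠ 0) := by
  obtain ⟨β, hβ⟩ := exists_matrix_repr hsurj B
  refine ⟨β.trace, β.det, fun a ↦ ?_, fun ⟨B', hB'⟩ ↦ det_ne_zero_of_rightInverse hinj hsurj hB' hβ⟩
  -- Cayley–Hamilton, entrywise
  have hCH : ∀ k m : Fin 2, (β * β) k m =
      β.trace * β k m - β.det * (1 : Matrix (Fin 2) (Fin 2) ℤ_[p]) k m := fun k m ↦ by
    have h := congr_fun (congr_fun (matrix_two_mul_self β) k) m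
    simpa [Matrix.sub_apply, Matrix.smul_apply] using h
  -- every `j_k` sees the relation, at every `a`
  have hk : ∀ (k : Fin 2) (a : A), j k (B (B a)) = j k (β.trace • B a - β.det • a) := by
    intro k a
    rw [matrix_repr_comp hβ hβ k a]
    simp_rw [hCH, sub_smul, map_sub, sum_sub_distrib]
    have h1 : ∑ m, j m ((β.trace * β k m) • a) = j k (β.trace • B a) := by
      simp_rw [mul_comm β.trace, mul_smul]
      rw [← hβ k (β.trace • a), map_smul]
    have h2 : ∑ m, j m ((β.det * (1 : Matrix (Fin 2) (Fin 2) ℤ_[p]) k m) • a) = j k (β.det • a) := by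
      simp_rw [mul_comm β.det, mul_smul]
      rw [← matrix_repr_id (j := j) k (β.det • a), LinearMap.id_apply]
    rw [h1, h2]
  -- characters separate points
  by_contra hne
  obtain ⟨χ, hχ⟩ := CharacterModule.exists_character_apply_ne_zero_of_ne_zero (sub_ne_zero.mpr hne)
  obtain ⟨c, hc⟩ := hsurj χ
  apply hχ
  have hx : ∀ c' : ℤ_[p], c' • (B (B a) - (β.trace • B a - β.det • a)) =
      B (B (c' • a)) - (β.trace • B (c' • a) - β.det • (c' • a)) := fun c' ↦ by
    rw [map_smul, map_smul, smul_sub, smul_sub, smul_comm c' β.trace, smul_comm c' β.det]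
  rw [show (χ : A →+ AddCircle (1 : ℚ)) (B (B a) - (β.trace • B a - β.det • a)) =
      ∑ k, j k (c k • (B (B a) - (β.trace • B a - β.det • a))) from hc _]
  refine sum_eq_zero fun k _ ↦ ?_
  rw [hx, map_sub, hk, sub_self]

end Matrices

end Summit.BirchSwinnertonDyer.BirchSwinnertonDyer.Theorems.AcTwistDeformation

end
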